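import Literature.Barriers.CriticalPhenomena.LongRangeTransitionLemma
import Literature.Probability.Percolation.MeanFieldBetaFromGamma
import Mathlib.MeasureTheory.Integral.Lebesgue.Add
import Mathlib.Algebra.Order.Floor.Semiring
import Mathlib.Analysis.Real.Sqrt
import HarnessLib

/-!
# The `1/|x-y|²` family percolates for `β > 1` and `p` close to `1` (Newman–Schulman)

Proofs-only companion of `Literature.Barriers.CriticalPhenomena.LongRangeDiscontinuity`: the
discharge `NewmanSchulman1986_transition_holds` of the named fact `NewmanSchulman1986_transition`
(for `β > 1` the family (1.7) of Aizenman–Newman, `K_1 = p`, `K_n = 1 - e^{-β/n²}`, has a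
positive percolation density once `p` is close enough to `1`), by the multi-scale argument of
Duminil-Copin, Garban and Tassion (*Long-range models in 1D revisited*, AIHP 60 (2024), proof of
Thm. 1(i), §2.3), on top of the renormalisation inequality `renormalisation_inequality`
(`LongRangeTransitionLemma.lean`):

* `real_bad_one_le` — at the first scale, `P[B_K is 1-bad] ≤ 2K(1-p)` (if all nearest-neighbour
  edges of the block are open the block is one cluster; union bound), DGT:
  "`p_{β,λ}(C₁, θ₁) ≤ ℙ[∃ {x,x+1} ⊆ B_{C₁} closed] ≤ C₁ e^{-λ}`";
* `real_good_le_two_mul_real_clusterSizeGe` — averaging and translation invariance: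
  `P[B_K θ-good] ≤ 2 P[|C(0)| ≥ K]` for `θ > 3/4` (DGT (2.10): "`(3/4) K_n ≤ E[|𝐂(B_{K_n})| 1_{…}]
  ≤ 2K_n ℙ[0 is in a cluster of size at least (3/2) K_n]`", with `K_n` in place of `3K_n/2`);
* `NewmanSchulman1986_transition_holds` — scales `K_{n+1} = C_{n+1} K_n` with `C_n = C₁ 2^n`,
  densities `θ_{n+1} = θ_n - C₀/C_{n+1}` from `θ₀' = 1`, the induction
  `u_n = P[B_{K_n} θ_n-bad] ≤ (1/100)/C_n²` (DGT: "By induction, we obtain that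
  `u_n ≤ (1/400) C_n^{-2}`"; we use `C_{n+1} = 2C_n` rather than `C_n = n³ C₁`, for which the
  printed induction closes from `n = 1` on), whence `P[|C(0)| ≥ K_n] ≥ 99/200` for all `n` and,
  letting `n → ∞`, `M = P[|C(0)| = ∞] ≥ 99/200 > 0` ("which by measurability implies that the
  probability that 0 is connected to infinity is larger than or equal to 3/8").

With `AizenmanNewman1986_family_of` (`LongRangeDiscontinuityProofs.lean`) this reduces
`AizenmanNewman1986_family` to the single remaining input `LongRangeDiscontinuity` (Aizenman–Newman
Prop. 1.1): `AizenmanNewman1986_family_of_longRangeDiscontinuity`.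

## References

* H. Duminil-Copin, C. Garban, V. Tassion, *Long-range models in 1D revisited*, AIHP 60 (2024)
  232–241, arXiv:2011.04642: Thm. 1(i) and its proof (§2.3, (2.10)).
* C. M. Newman, L. S. Schulman, *One-dimensional `1/|j-i|^s` percolation models: the existence
  of a transition for `s ≤ 2`*, Comm. Math. Phys. 104 (1986) 547–571.
* M. Aizenman, C. M. Newman, Comm. Math. Phys. 107 (1986) 611–647: §1 (iii), p. 614.
-/

noncomputable section

open scoped Classical

namespace Literature.Barriers.CriticalPhenomena

open _root_.MeasureTheory Finset unitInterval Filter Literature.Probability.LatticeModels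
  Literature.Probability.Percolation
open scoped ENNReal Topology

/-! ### The first scale: nearest-neighbour edges -/

/-- If all nearest-neighbour edges `{x, x+1}`, `-K ≤ x < K - 1`, of `B_K = [-K, K)` are open, the
block cluster of `-K` is the whole block. [folklore] -/
theorem blkCluster_eq_blk_of_forall_mem {K : ℕ} {ω : BondConfig ℤ}
    (h : ∀ x : ℤ, -(K : ℤ) ≤ x → x + 1 < K → s(x, x + 1) ∈ ω) :
    blkCluster ω K 0 (-(K : ℤ)) = blk K 0 := by
  refine Finset.Subset.antisymm (locCluster_subset ω _ _ _) fun y hy => ?_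
  rw [mem_locCluster]
  refine ⟨hy, ?_⟩
  have hy' := mem_blk.1 hy
  simp only [zero_sub, mul_neg, mul_one, zero_add] at hy'
  obtain ⟨hy1, hy2⟩ := hy'
  induction y, hy1 using Int.leInduction with
  | base => exact SimpleGraph.Reachable.refl _
  | succ y hKy ih =>
    refine (ih (Finset.mem_coe.2 (mem_blk.2 ⟨by linarith, by linarith⟩)) (by linarith)).trans
      (SimpleGraph.Adj.reachable ?_)
    rw [openGraph_adj]
    refine ⟨⟨h y hKy hy2, mk_mem_blkEdges.2 ⟨mem_blk.2 ⟨by linarith, by linarith⟩, hy⟩⟩, by linarith⟩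

/-- **First scale** (DGT: "`p_{β,λ}(C₁, θ₁) ≤ ℙ[∃ {x, x+1} ⊆ B_{C₁} closed] ≤ C₁ e^{-λ}`"): for the
family (1.7) at nearest-neighbour density `p`, `P[B_K is 1-bad] ≤ 2K (1 - p)`.
[cite: DuminilcopinGarbanTassion2024, §2.3 (proof of Thm. 1(i), choice of λ)] -/
theorem real_bad_one_le (β : ℝ) (hβ : 0 ≤ β) (p : unitInterval) {K : ℕ} (hK : 1 ≤ K) :
    (longRangePercolation (anFamily β hβ p)).real (bad K 1 0) ≤ 2 * K * (1 - (p : ℝ)) := by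
  set μ := longRangePercolation (anFamily β hβ p) with hμ
  haveI : IsProbabilityMeasure μ := instIsProbabilityMeasureLongRangePercolation _
  set X : Finset ℤ := Finset.Ico (-(K : ℤ)) ((K : ℤ) - 1) with hX
  have hcover : bad K 1 0 ⊆ ⋃ x ∈ X, {ω : BondConfig ℤ | s(x, x + 1) ∉ ω} := by
    intro ω hω
    by_contra hno
    simp only [Set.mem_iUnion, Set.mem_setOf_eq, not_exists, not_not, exists_prop, not_and] at hno
    refine hω ⟨-(K : ℤ), mem_blk.2 ⟨by simp, by push_cast; omega⟩, ?_⟩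
    rw [blkCluster_eq_blk_of_forall_mem fun x h1 h2 => hno x (by rw [hX, Finset.mem_Ico]; omega),
      card_blk]
    push_cast; linarith
  have hterm : ∀ x ∈ X, μ.real {ω : BondConfig ℤ | s(x, x + 1) ∉ ω} = 1 - (p : ℝ) := by
    intro x _
    rw [hμ]; unfold longRangePercolation
    rw [prodBernoulli_real_setOf_notMem, Sym2.lift_mk]
    simp only
    rw [anFamily_of_le_one β hβ p (by omega)]
  have hcardX : (X.card : ℝ) ≤ 2 * K := by
    rw [hX, Int.card_Ico]
    have : ((K : ℤ) - 1 - -(K : ℤ)).toNat ≤ 2 * K := by omega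
    exact_mod_cast this
  have hp1 : 0 ≤ 1 - (p : ℝ) := sub_nonneg.2 p.2.2
  calc μ.real (bad K 1 0) ≤ μ.real (⋃ x ∈ X, {ω : BondConfig ℤ | s(x, x + 1) ∉ ω}) :=
        measureReal_mono hcover (measure_ne_top μ _)
    _ ≤ ∑ x ∈ X, μ.real {ω : BondConfig ℤ | s(x, x + 1) ∉ ω} := measureReal_biUnion_finset_le _ _
    _ = X.card * (1 - (p : ℝ)) := by rw [Finset.sum_congr rfl hterm, Finset.sum_const, nsmul_eq_mul]
    _ ≤ 2 * K * (1 - (p : ℝ)) := mul_le_mul_of_nonneg_right hcardX hp1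

/-! ### Translation invariance of `{|C(x)| ≥ n}` -/

/-- Translating a configuration translates open clusters: `{|C(x + s)| ≥ n}` pulls back to
`{|C(x)| ≥ n}`. [folklore] -/
theorem preimage_relabel_clusterSizeGe (s x : ℤ) (n : ℕ) :
    (fun ω : BondConfig ℤ => sym2Equiv (Equiv.addRight s) '' ω) ⁻¹' clusterSizeGe (x + s) n =
      clusterSizeGe x n := by
  ext ω
  rw [Set.mem_preimage, mem_clusterSizeGe, mem_clusterSizeGe]
  have h := openClusterIn_relabel (Equiv.addRight s) (K := ⊤) (K' := ⊤)
    (fun u v => by simp only [SimpleGraph.top_adj, ne_eq, (Equiv.addRight s).injective.ne_iff]) ω x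
  rw [openClusterIn_top, openClusterIn_top] at h
  have hx : Equiv.addRight s x = x + s := rfl
  rw [hx] at h
  rw [show sym2Equiv (Equiv.addRight s) '' ω = BondConfig.relabel (sym2Equiv (Equiv.addRight s)) ω
    from rfl, h, (Equiv.addRight s).injective.encard_image]

/-- **`P[|C(x)| ≥ n] = P[|C(0)| ≥ n]`** in every model `longRangePercolation K`.
[cite: DuminilcopinGarbanTassion2024, §2.3 (proof of Thm. 1(i), "translation invariance")] -/
theorem longRangePercolation_real_clusterSizeGe_eq (Kf : ℕ → unitInterval) (x : ℤ) (n : ℕ) :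
    (longRangePercolation Kf).real (clusterSizeGe x n) = (longRangePercolation Kf).real (clusterSizeGe 0 n) := by
  have h := preimage_relabel_clusterSizeGe x 0 n
  rw [zero_add] at h
  rw [← h]
  unfold longRangePercolation
  exact (prodBernoulli_real_preimage_image_equiv _ _ (fun z => lrParam_sym2Equiv_addRight Kf x z)
    (measurableSet_clusterSizeGe x n)).symm

/-! ### Averaging: a good block forces big clusters -/

/-- **Averaging** (DGT (2.10)): for `θ > 3/4` (indeed `θ ≥ 1/2`) and `K ≥ 1`,
`P[B_K is θ-good] ≤ 2 P[|C(0)| ≥ K]`. On `{B_K good}` the big block cluster has `≥ 2θK ≥ K`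
vertices, each of which lies in a cluster of size `≥ K`; so `K · 1_{good} ≤ Σ_{x ∈ B_K}
1_{|C(x)| ≥ K}` pointwise, and integrating, `K P[good] ≤ Σ_x P[|C(x)| ≥ K] = 2K P[|C(0)| ≥ K]`.
[cite: DuminilcopinGarbanTassion2024, §2.3 (proof of Thm. 1(i), (2.10))] -/
theorem real_good_le_two_mul_real_clusterSizeGe (Kf : ℕ → unitInterval) {K : ℕ} (hK : 1 ≤ K)
    {θ : ℝ} (hθ : 3 / 4 < θ) :
    (longRangePercolation Kf).real (good K θ 0) ≤
      2 * (longRangePercolation Kf).real (clusterSizeGe (0 : ℤ) K) := by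
  set μ := longRangePercolation Kf with hμ
  haveI : IsProbabilityMeasure μ := instIsProbabilityMeasureLongRangePercolation _
  set B := blk K 0 with hB
  set H : ℤ → Set (BondConfig ℤ) := fun x => clusterSizeGe x K with hH
  -- pointwise inequality
  have hpt : ∀ ω, (K : ℝ≥0∞) * (good K θ 0).indicator 1 ω ≤ ∑ x ∈ B, (H x).indicator 1 ω := by
    intro ω
    by_cases hω : ω ∈ good K θ 0
    · have hω' := hω
      obtain ⟨x₀, hx₀, hcard⟩ := hω'
      rw [Set.indicator_of_mem hω, Pi.one_apply, mul_one]
      set cl := blkCluster ω K 0 x₀ with hcl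
      have hKcl : K ≤ cl.card := by
        have hK0 : (0 : ℝ) < K := by exact_mod_cast hK
        have : (K : ℝ) ≤ cl.card := by nlinarith
        exact_mod_cast this
      have hmem : ∀ x ∈ cl, ω ∈ H x := by
        intro x hx
        rw [hH]
        show ((K : ℕ) : ℕ∞) ≤ (openCluster ω x).encard
        have hsub : (↑cl : Set ℤ) ⊆ openCluster ω x := by
          intro y hy
          have h1 := (mem_locCluster.1 hx).2
          have h2 := (mem_locCluster.1 (Finset.mem_coe.1 hy)).2
          exact (h1.symm.trans h2).mono (openGraph_mono Set.inter_subset_left)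
        calc ((K : ℕ) : ℕ∞) ≤ cl.card := by exact_mod_cast hKcl
          _ = (↑cl : Set ℤ).encard := (Set.encard_coe_eq_coe_finsetCard cl).symm
          _ ≤ (openCluster ω x).encard := Set.encard_mono hsub
      calc (K : ℝ≥0∞) ≤ cl.card := by exact_mod_cast hKcl
        _ = ∑ x ∈ cl, (H x).indicator 1 ω := by
            rw [Finset.sum_congr rfl fun x hx => Set.indicator_of_mem (hmem x hx) 1, Finset.sum_const]
            simp
        _ ≤ ∑ x ∈ B, (H x).indicator 1 ω :=
            Finset.sum_le_sum_of_subset_of_nonneg (locCluster_subset ω _ _ _) fun _ _ _ => bot_le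
    · rw [Set.indicator_of_notMem hω, mul_zero]; exact bot_le
  have hmeasH : ∀ x, MeasurableSet (H x) := fun x => measurableSet_clusterSizeGe x K
  have hint : (K : ℝ≥0∞) * μ (good K θ 0) ≤ ∑ x ∈ B, μ (H x) := by
    calc (K : ℝ≥0∞) * μ (good K θ 0) = ∫⁻ ω, (K : ℝ≥0∞) * (good K θ 0).indicator 1 ω ∂μ := by
          rw [lintegral_const_mul _ (measurable_one.indicator (measurableSet_good K θ 0)),
            lintegral_indicator_one (measurableSet_good K θ 0)]
      _ ≤ ∫⁻ ω, ∑ x ∈ B, (H x).indicator 1 ω ∂μ := lintegral_mono hpt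
      _ = ∑ x ∈ B, ∫⁻ ω, (H x).indicator 1 ω ∂μ :=
          lintegral_finsetSum B fun x _ => measurable_one.indicator (hmeasH x)
      _ = ∑ x ∈ B, μ (H x) := Finset.sum_congr rfl fun x _ => lintegral_indicator_one (hmeasH x)
  -- translation invariance and `#B = 2K`
  have hsum : ∑ x ∈ B, μ (H x) = (2 * K : ℕ) * μ (H 0) := by
    have : ∀ x ∈ B, μ (H x) = μ (H 0) := by
      intro x _
      have h := longRangePercolation_real_clusterSizeGe_eq Kf x K
      rw [measureReal_def, measureReal_def, ENNReal.toReal_eq_toReal_iff' (measure_ne_top _ _)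
        (measure_ne_top _ _)] at h
      exact h
    rw [Finset.sum_congr rfl this, Finset.sum_const, hB, card_blk, nsmul_eq_mul]
  rw [hsum] at hint
  have hK0 : (K : ℝ≥0∞) ≠ 0 := by exact_mod_cast (by omega : K ≠ 0)
  have h2 : μ (good K θ 0) ≤ 2 * μ (H 0) := by
    have : (K : ℝ≥0∞) * μ (good K θ 0) ≤ (K : ℝ≥0∞) * (2 * μ (H 0)) := by
      calc (K : ℝ≥0∞) * μ (good K θ 0) ≤ ((2 * K : ℕ) : ℝ≥0∞) * μ (H 0) := hint
        _ = (K : ℝ≥0∞) * (2 * μ (H 0)) := by push_cast; ring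
    exact (ENNReal.mul_le_mul_iff_right hK0 (ENNReal.natCast_ne_top K)).1 this
  calc μ.real (good K θ 0) = (μ (good K θ 0)).toReal := rfl
    _ ≤ (2 * μ (H 0)).toReal := ENNReal.toReal_mono (ENNReal.mul_ne_top (by norm_num) (measure_ne_top _ _)) h2
    _ = 2 * μ.real (H 0) := by rw [ENNReal.toReal_mul, measureReal_def]; norm_num

/-! ### The multi-scale induction -/

/-- Arithmetic of the induction step: with `a = 1/100` and `C' = 2C`,
`u ≤ a/C²` implies `u/100 + 4 C'² u² ≤ a/C'²` (`0.04 + 0.64 ≤ 1`). [folklore] -/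
theorem renorm_step_arith {u c : ℝ} (hc : 0 < c) (hu0 : 0 ≤ u) (hu : u ≤ (1 / 100) / c ^ 2) :
    u / 100 + 4 * (2 * c) ^ 2 * u ^ 2 ≤ (1 / 100) / (2 * c) ^ 2 := by
  have hc2 : 0 < c ^ 2 := by positivity
  have hmono : u / 100 + 4 * (2 * c) ^ 2 * u ^ 2 ≤
      (1 / 100) / c ^ 2 / 100 + 4 * (2 * c) ^ 2 * ((1 / 100) / c ^ 2) ^ 2 :=
    add_le_add (div_le_div_of_nonneg_right hu (by norm_num))
      (mul_le_mul_of_nonneg_left (pow_le_pow_left₀ hu0 hu 2) (by positivity))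
  have e1 : (1 / 100 : ℝ) / c ^ 2 / 100 + 4 * (2 * c) ^ 2 * ((1 / 100) / c ^ 2) ^ 2 = (17 / 10000) / c ^ 2 := by
    field_simp; ring
  have e2 : (1 / 100 : ℝ) / (2 * c) ^ 2 = (25 / 10000) / c ^ 2 := by
    field_simp; ring
  rw [e1] at hmono
  rw [e2]
  exact hmono.trans (div_le_div_of_nonneg_right (by norm_num) hc2.le)

/-- **Newman–Schulman's transition, after Duminil-Copin–Garban–Tassion** (discharge of
`NewmanSchulman1986_transition`): for every `β > 1` there is `p_c < 1` such that the family (1.7)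
(`K_1 = p`, `K_n = 1 - e^{-β/n²}`) has positive percolation density `M = P[|C(0)| = ∞]` for
every `p > p_c`. Proof as printed (DGT Thm. 1(i)): fix `θ₀ ∈ (3/4, 1)` with `β θ₀² > 1`, take
`C₀` from the renormalisation inequality and `C₁ ≥ C₀/(1 - θ₀)`; along `K_{n+1} = C_{n+1} K_n`,
`C_n = C₁ 2^n`, `θ_{n+1} = θ_n - C₀/C_{n+1}` (`θ_0 = 1`, so `θ_n ≥ θ₀`), the bad-block
probabilities satisfy `u_{n+1} ≤ u_n/100 + 4 C_{n+1}² u_n²`, and `u_0 ≤ 2C₁(1-p) ≤ (1/100)/C₁²`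
for `p > 1 - 1/(200 C₁³) =: p_c`; by induction `u_n ≤ (1/100)/C_n²`, so `P[B_{K_n} good] ≥ 99/100`,
`P[|C(0)| ≥ K_n] ≥ 99/200` (averaging), and `M = lim_n P[|C(0)| ≥ K_n] ≥ 99/200 > 0`.
[cite: DuminilcopinGarbanTassion2024, Thm. 1(i) (proof, §2.3)] [cite: NewmanSchulman1986, main theorem (s = 2)]
[cite: AizenmanNewman1986, §1 (iii) p. 614] -/
theorem NewmanSchulman1986_transition_holds : NewmanSchulman1986_transition := by
  intro β hβ1
  have hβ : (0 : ℝ) ≤ β := by linarith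
  -- choice of `θ₀`
  set m : ℝ := max (3 / 4) (1 / Real.sqrt β) with hm
  have hsqrt : 0 < Real.sqrt β := Real.sqrt_pos.2 (by linarith)
  have hm1 : m < 1 := by
    refine max_lt (by norm_num) ?_
    rw [div_lt_one hsqrt, Real.lt_sqrt zero_le_one]
    linarith
  set θ₀ : ℝ := (1 + m) / 2 with hθ₀def
  have hθ₀m : m < θ₀ := by rw [hθ₀def]; linarith
  have hθ₀ : 3 / 4 < θ₀ := lt_of_le_of_lt (le_max_left _ _) hθ₀m
  have hθ₀1 : θ₀ < 1 := by rw [hθ₀def]; linarith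
  have hγ : 1 < β * θ₀ ^ 2 := by
    have h1 : 1 / Real.sqrt β < θ₀ := lt_of_le_of_lt (le_max_right _ _) hθ₀m
    have h2 : (1 / Real.sqrt β) ^ 2 = 1 / β := by
      rw [div_pow, one_pow, Real.sq_sqrt hβ]
    have h3 : 1 / β < θ₀ ^ 2 := by
      rw [← h2]; exact pow_lt_pow_left₀ h1 (by positivity) two_ne_zero
    have hβ0 : (0 : ℝ) < β := by linarith
    rw [div_lt_iff₀ hβ0] at h3
    linarith
  obtain ⟨C₀, hC₀3, hren⟩ := renormalisation_inequality β hβ hθ₀ hγ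
  -- the scales
  set C₁ : ℕ := ⌈(C₀ : ℝ) / (1 - θ₀)⌉₊ + C₀ with hC₁
  have hC₁C₀ : C₀ ≤ C₁ := Nat.le_add_left _ _
  have hC₁3 : 3 ≤ C₁ := hC₀3.trans hC₁C₀
  have hC₁pos : (0 : ℝ) < C₁ := by exact_mod_cast (by omega : 0 < C₁)
  have hratio : (C₀ : ℝ) / C₁ ≤ 1 - θ₀ := by
    rw [div_le_iff₀ hC₁pos]
    have h1 : (C₀ : ℝ) / (1 - θ₀) ≤ C₁ := by
      rw [hC₁]; push_cast
      linarith [Nat.le_ceil ((C₀ : ℝ) / (1 - θ₀)), (Nat.cast_nonneg C₀ : (0 : ℝ) ≤ C₀)]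
    rwa [div_le_iff₀ (by linarith), mul_comm] at h1
  set Cn : ℕ → ℕ := fun n => C₁ * 2 ^ n with hCn
  set Kn : ℕ → ℕ := fun n => Nat.rec C₁ (fun k ih => Cn (k + 1) * ih) n with hKn
  set θn : ℕ → ℝ := fun n => 1 - (C₀ : ℝ) / C₁ * (1 - (1 / 2) ^ n) with hθn
  have hK0 : Kn 0 = C₁ := rfl
  have hKsucc : ∀ n, Kn (n + 1) = Cn (n + 1) * Kn n := fun n => rfl
  have hCnR : ∀ n, ((Cn n : ℕ) : ℝ) = C₁ * 2 ^ n := fun n => by rw [hCn]; push_cast; ring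
  have hCn_ge : ∀ n, C₀ ≤ Cn n := fun n =>
    hC₁C₀.trans (by rw [hCn]; exact Nat.le_mul_of_pos_right _ (Nat.pow_pos two_pos))
  have hCn_pos : ∀ n, (0 : ℝ) < Cn n := fun n => by rw [hCnR]; positivity
  have hKn_pos : ∀ n, 1 ≤ Kn n := by
    intro n
    induction n with
    | zero => rw [hK0]; omega
    | succ n ih =>
      rw [hKsucc]
      exact one_le_mul ((hC₀3.trans (hCn_ge _)).trans' (by norm_num)) ih
  have hKn_gt : ∀ n, n < Kn n := by
    intro n
    induction n with
    | zero => rw [hK0]; omega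
    | succ n ih =>
      rw [hKsucc]
      have : 2 ≤ Cn (n + 1) := (hCn_ge _).trans' (by omega)
      nlinarith [hKn_pos n]
  have hθn0 : θn 0 = 1 := by rw [hθn]; simp
  have hθn_le : ∀ n, θn n ≤ 1 := fun n => by
    rw [hθn]; simp only
    have : (0 : ℝ) ≤ (C₀ : ℝ) / C₁ * (1 - (1 / 2) ^ n) :=
      mul_nonneg (by positivity) (sub_nonneg.2 (pow_le_one₀ (by norm_num) (by norm_num)))
    linarith
  have hθn_ge : ∀ n, θ₀ ≤ θn n := fun n => by
    rw [hθn]; simp only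
    have h1 : (C₀ : ℝ) / C₁ * (1 - (1 / 2) ^ n) ≤ (C₀ : ℝ) / C₁ :=
      mul_le_of_le_one_right (by positivity) (by linarith [pow_nonneg (by norm_num : (0:ℝ) ≤ 1/2) n])
    linarith
  have hθn_succ : ∀ n, θn (n + 1) = θn n - C₀ / (Cn (n + 1) : ℝ) := fun n => by
    rw [hθn, hCnR]; simp only
    rw [one_div_pow, one_div_pow, pow_succ]
    field_simp
    ring
  -- the threshold
  refine ⟨1 - 1 / (200 * (C₁ : ℝ) ^ 3), by
    have : (0 : ℝ) < 1 / (200 * (C₁ : ℝ) ^ 3) := by positivity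
    linarith, ?_⟩
  intro p hp
  set μ := longRangePercolation (anFamily β hβ p) with hμ
  haveI : IsProbabilityMeasure μ := instIsProbabilityMeasureLongRangePercolation _
  -- the induction
  have hind : ∀ n, μ.real (bad (Kn n) (θn n) 0) ≤ (1 / 100) / ((Cn n : ℕ) : ℝ) ^ 2 := by
    intro n
    induction n with
    | zero =>
      rw [hK0, hθn0, hCnR, pow_zero, mul_one]
      calc μ.real (bad C₁ 1 0) ≤ 2 * C₁ * (1 - (p : ℝ)) := real_bad_one_le β hβ p (by omega)
        _ ≤ 2 * C₁ * (1 / (200 * (C₁ : ℝ) ^ 3)) := by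
            refine mul_le_mul_of_nonneg_left (by linarith) (by positivity)
        _ = (1 / 100) / (C₁ : ℝ) ^ 2 := by field_simp; ring
    | succ n ih =>
      have hstep := hren p (θn n) (hθn_ge n) (hθn_le n) (Kn n) (Cn (n + 1)) (hKn_pos n) (hCn_ge _)
        (μ.real (bad (Kn n) (θn n) 0)) (fun j => (longRangePercolation_real_bad_eq _ _ _ j).le)
      rw [hKsucc, hθn_succ]
      refine hstep.trans ?_
      have h2 : ((Cn (n + 1) : ℕ) : ℝ) = 2 * ((Cn n : ℕ) : ℝ) := by rw [hCnR, hCnR]; ring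
      rw [h2]
      exact renorm_step_arith (hCn_pos n) measureReal_nonneg ih
  -- good blocks, big clusters
  have hgood : ∀ n, 99 / 100 ≤ μ.real (good (Kn n) (θn n) 0) := by
    intro n
    have h1 := hind n
    have h2 : μ.real (bad (Kn n) (θn n) 0) = 1 - μ.real (good (Kn n) (θn n) 0) := by
      rw [bad, measureReal_compl (measurableSet_good _ _ _), probReal_univ]
    have h3 : (1 / 100 : ℝ) / ((Cn n : ℕ) : ℝ) ^ 2 ≤ 1 / 100 := by
      rw [div_le_iff₀ (by positivity)]
      have : (1 : ℝ) ≤ ((Cn n : ℕ) : ℝ) := by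
        have := (hC₀3.trans (hCn_ge n)); exact_mod_cast (by omega : 1 ≤ Cn n)
      nlinarith
    linarith
  have hbig : ∀ n, 99 / 200 ≤ μ.real (clusterSizeGe (0 : ℤ) (Kn n)) := by
    intro n
    have := real_good_le_two_mul_real_clusterSizeGe (anFamily β hβ p) (hKn_pos n)
      (lt_of_lt_of_le hθ₀ (hθn_ge n))
    linarith [hgood n]
  -- letting `n → ∞`
  have hlim : μ (percolatesAt (0 : ℤ)) = ⨅ k : ℕ, μ (clusterSizeGe (0 : ℤ) k) := by
    rw [← iInter_clusterSizeGe]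
    exact (clusterSizeGe_antitone (0 : ℤ)).measure_iInter
      (fun k => (measurableSet_clusterSizeGe (0 : ℤ) k).nullMeasurableSet) ⟨0, measure_ne_top _ _⟩
  have hinf : ENNReal.ofReal (99 / 200) ≤ μ (percolatesAt (0 : ℤ)) := by
    rw [hlim]
    refine le_iInf fun k => ?_
    calc ENNReal.ofReal (99 / 200) ≤ ENNReal.ofReal (μ.real (clusterSizeGe (0 : ℤ) (Kn k))) :=
          ENNReal.ofReal_le_ofReal (hbig k)
      _ = μ (clusterSizeGe (0 : ℤ) (Kn k)) := ENNReal.ofReal_toReal (measure_ne_top _ _)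
      _ ≤ μ (clusterSizeGe (0 : ℤ) k) := measure_mono (clusterSizeGe_antitone (0 : ℤ) (hKn_gt k).le)
  show 0 < μ.real (percolatesAt (0 : ℤ))
  have : (99 / 200 : ℝ) ≤ μ.real (percolatesAt (0 : ℤ)) := by
    rw [measureReal_def, ← ENNReal.ofReal_le_iff_le_toReal (measure_ne_top _ _)]
    exact hinf
  linarith

/-- **`AizenmanNewman1986_family` from Prop. 1.1 alone**: with the transition proved, the phase
diagram of the `1/|x|²` family follows from the barrier `LongRangeDiscontinuity`
(Aizenman–Newman 1986, Prop. 1.1) by `AizenmanNewman1986_family_of`.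
[cite: AizenmanNewman1986, §1 (iii) pp. 614–615 ((1.7), (a)–(b))] -/
theorem AizenmanNewman1986_family_of_longRangeDiscontinuity (hAN : LongRangeDiscontinuity) :
    AizenmanNewman1986_family :=
  AizenmanNewman1986_family_of NewmanSchulman1986_transition_holds hAN

end Literature.Barriers.CriticalPhenomena

end
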